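/-
Copyright (c) 2026 the pub-hodgecm-mathlib formalisation cell (harness21).  Prover seat hodgecm-mathlib-K2E4-p23 (g3), Track B ∕ K2-LIT, h413 =
`stmt-HodgeConjecture-24833`, ENGINE E1, 5Res campaign «ENDGAME BY FAMILIES», RUNG 1 — THE FINAL, EDITION 2 (binder-free): ★ p861721's
`residual_invariants_finiteDimensional_maximalLevel_cm_final` with its two visible inputs `hVc` (★ p861779) and `hSD` (★ `selfDual_block_package`, this seat) DISCHARGED BY NAME.
-/
import Summits.HodgeConjecture.HodgeConjecture.Theorems.K2E1ResidualSphericalFiniteMaximalLevelCMTwoFinal   -- ★ p861721 (K2E4-p14 g10): ED. 1 `residual_invariants_finiteDimensional_maximalLevel_cm_final` (`hVc`, `hSD` visible), ★ `m1_level_witness`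
import Summits.HodgeConjecture.HodgeConjecture.Theorems.K2E1ResidualBlockPackageSelfDualM1CMTwo             -- ★ (this seat): `selfDual_block_package` (the `hSD` binder per self-dual block)
import Summits.HodgeConjecture.HodgeConjecture.Theorems.K2E1ChiSectionContinuousMaximalLevelCMTwo          -- ★ p861779 (K2E2-p12 g8): `hVc_maximalLevel`, `hVc_maximalLevel_one` (the `hVc` binder)
import HarnessLib

/-!
# K2·E1 — `K2E1ResidualSphericalFiniteMaximalLevelCMTwoClosed`: RUNG 1 OF THE 5Res LADDER, BINDER-FREE — «`(L²_res(U(1,1)_{L∕L⁺}, 𝔓))^{K_∞·K_max,f}` IS FINITE-DIMENSIONAL»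

Track B ∕ K2-LIT, crux h413 = `stmt-HodgeConjecture-24833`, route of record `HCCMUnconditional`; cell `hodgecm-mathlib`, squad K2, ENGINE E1.  Prover seat
`hodgecm-mathlib-K2E4-p23` (g3); E1 dealer K2E1-plan (g7) closing sequence (294)(iii).  THEOREMS ONLY (no `def`, no `instance`, no notation, no named-fact hypothesis, no `sorry`);
lane `--supports stmt-HodgeConjecture-24833 --as helper` (count-neutral).  CLOSES NO SOCKET of `stmt-HodgeConjecture-24833`: RUNG 1 ≠ 5Res.

THE ASSEMBLY.  ★ p861721 ED. 1 proves the finite-dimensionality of the `K_∞·GL₂(𝒪̂_L)`-invariants of `L²_res(U(1,1), 𝔓)` (trivial `K_∞`-type, `𝔓` the NAMED Borel datum) from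
the two-family socket ★ p861518, `hKad` ★ p861107, `hEis` ★ p861046, the finite self-dual index ★ p861076, the OFF-DUAL package ★ p861419, leaving VISIBLE (C) `hVc` = continuity of
the sections of `V(χ′, K, 1)` for every `χ′` and `hSD` = the SELF-DUAL per-block ∃-package.  Here both are fed BY NAME: (C) ★ `hVc_maximalLevel` [BorelJacquet1979, §4.1]
(`K_max` is open, sections are right-`K`-invariant); `hSD` ★ `selfDual_block_package` at the M1 level data ★ `m1_level_witness`, model measure `haar` on the compact `K`,
unitarity ★ `HeckeCharacter.isUnitary_of_map_posRealIdele` (ray-trivial ⇒ unitary [CasselsFrohlichANT1967, Ch. II §16]), `hVc` ★ `hVc_maximalLevel_one`, `gen := ` the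
C⁰-bricks of the block with `hgen := rfl` [MoeglinWaldspurger1995, II.2.4, IV.3.12, V.3.13].
HONEST LABEL: HC_CM is proved only modulo the 7 printed citations (2 remaining named inputs: hLiu418 = `stmt-HodgeConjecture-24832`, h413 = `stmt-HodgeConjecture-24833`) until rung 0
closes; RUNG 1 of the 5Res ladder is now a binder-free theorem modulo those citations; this file asserts no named fact and closes no socket; count-neutral.

## References
* [MoeglinWaldspurger1995] C. Mœglin, J.-L. Waldspurger, *Spectral decomposition and Eisenstein series* (1995), I.2.18, II.2.4, IV.3.12, V.3.13.
* [HarishChandra1968] Harish-Chandra, *Automorphic forms on semisimple Lie groups*, LNM 62 (1968), Thm. 1.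
* [BorelJacquet1979] A. Borel, H. Jacquet, *Automorphic forms and automorphic representations*, PSPM 33.1 (1979), §4.1, §4.6.
* [CasselsFrohlichANT1967] J. W. S. Cassels, A. Fröhlich (eds.), *Algebraic Number Theory* (1967), Ch. II §16, Ch. XV.
-/

set_option autoImplicit false
-- the mandated namespace repeats the single-problem summit's segment (`HodgeConjecture.HodgeConjecture`)
set_option linter.dupNamespace false

noncomputable section

open MeasureTheory MeasureTheory.Measure Filter Topology CompactlySupported NumberField NumberField.mixedEmbedding NumberField.InfinitePlace IsDedekindDomain Set Complex
open scoped ENNReal NNReal ComplexConjugate InnerProductSpace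
open Literature.NumberTheory Literature.NumberTheory.Automorphic Literature.NumberTheory.Automorphic.UnitaryGroup AdelicGroupData ContRepresentation
open Literature.NumberTheory.GaloisRepresentations (HeckeCharacter HeckeCharacter.isUnitary_of_map_posRealIdele)
open Summit.HodgeConjecture.HodgeConjecture.Cruxes.H413.K2E1BorelEisensteinU
open Summit.HodgeConjecture.HodgeConjecture.Cruxes.H413.K2E1CharacterEisensteinU2Defs
open Summit.HodgeConjecture.HodgeConjecture.Cruxes.H413.K2E1ChiSectionSpaceU2Defs
open Summit.HodgeConjecture.HodgeConjecture.Cruxes.H413.K2E1CuspidalSpectrumUnitary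
open Summit.HodgeConjecture.HodgeConjecture.Cruxes.H413.K2E1ResidualSphericalFiniteMaximalLevelCMTwoFinal (residual_invariants_finiteDimensional_maximalLevel_cm_final)
open Summit.HodgeConjecture.HodgeConjecture.Cruxes.H413.K2E1ResidualBlockPackageOffDualM1CMTwo (m1_level_witness)
open Summit.HodgeConjecture.HodgeConjecture.Cruxes.H413.K2E1ResidualBlockPackageSelfDualM1CMTwo (selfDual_block_package)
open Summit.HodgeConjecture.HodgeConjecture.Cruxes.H413.K2E1ChiSectionContinuousMaximalLevelCMTwo (hVc_maximalLevel hVc_maximalLevel_one)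

namespace Summit.HodgeConjecture.HodgeConjecture.Cruxes.H413.K2E1ResidualSphericalFiniteMaximalLevelCMTwoClosed

-- all binders explicit (no section `variable`s): the auxiliary archimedean Haar measure `νinf` (used by the Hecke operator inside `hSD`) does not occur in the conclusion,
-- and Lean's `unusedSectionVars` check is thereby skipped (it is the > 10-minute wall of big files in this chain, cf. ★ `selfDual_block_package`)
/-- **RUNG 1 — «`(L²_res(U(1,1)_{L∕L⁺}, 𝔓))^{K_∞·K_max,f}` IS FINITE-DIMENSIONAL», BINDER-FREE** (= ★ p861721 `residual_invariants_finiteDimensional_maximalLevel_cm_final` with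
(C) `hVc` ★ `hVc_maximalLevel` and `hSD` ★ `selfDual_block_package` — at ★ `m1_level_witness`, model measure `haar` on `K`, ★ `HeckeCharacter.isUnitary_of_map_posRealIdele`,
★ `hVc_maximalLevel_one`, `gen := ` the C⁰-bricks, `hgen := rfl` — fed BY NAME).  Frame: `G = U(J₂)` over `L∕L⁺`, trivial `K_∞`-type `χ ≡ 1` on `K_∞ = G(L⁺ ⊗ ℝ) ∩ U(1 ⊗ 1)`,
level `K′_f = GL₂(𝒪̂_L) ∩ G(𝔸_f)` with its normalised idempotent `e`, block projector `P = P_1 ∘L R_f(e)`, NAMED parabolic datum `𝔓` (`Nonempty 𝔓.ι`, radicals `= N(𝔸)`).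
[cite: MoeglinWaldspurger1995, I.2.18, II.2.4, IV.3.12, V.3.13] [cite: HarishChandra1968, Thm. 1] [cite: BorelJacquet1979, §4.1, §4.6] [cite: CasselsFrohlichANT1967, Ch. II §16 Theorem] -/
theorem residual_invariants_finiteDimensional_maximalLevel_cm
    {L : Type} [Field L] [NumberField L] [IsCMField L]
    (μ : Measure (quasiSplit (↥(maximalRealSubfield L)) L (IsCMField.complexConj L) 2).automorphicQuotient) [(quasiSplit (↥(maximalRealSubfield L)) L (IsCMField.complexConj L) 2).IsAutomorphicMeasure μ]
    [MeasurableSpace (UnitaryGroup.arch (↥(maximalRealSubfield L)) L (IsCMField.complexConj L) 2 ((StdForm.antidiagonal 2).over L))] [BorelSpace (UnitaryGroup.arch (↥(maximalRealSubfield L)) L (IsCMField.complexConj L) 2 ((StdForm.antidiagonal 2).over L))]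
    [MeasurableSpace (finAdelic (↥(maximalRealSubfield L)) L (IsCMField.complexConj L) 2 ((StdForm.antidiagonal 2).over L))] [BorelSpace (finAdelic (↥(maximalRealSubfield L)) L (IsCMField.complexConj L) 2 ((StdForm.antidiagonal 2).over L))]
    (νinf : Measure (UnitaryGroup.arch (↥(maximalRealSubfield L)) L (IsCMField.complexConj L) 2 ((StdForm.antidiagonal 2).over L))) [IsHaarMeasure νinf] [νinf.IsInvInvariant] [SFinite νinf]
    (νf : Measure (finAdelic (↥(maximalRealSubfield L)) L (IsCMField.complexConj L) 2 ((StdForm.antidiagonal 2).over L))) [IsFiniteMeasureOnCompacts νf] [νf.IsMulLeftInvariant] [νf.IsInvInvariant] [νf.IsOpenPosMeasure]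
    [MeasurableSpace ↥(UnitaryGroup.arch (↥(maximalRealSubfield L)) L (IsCMField.complexConj L) 2 ((StdForm.antidiagonal 2).over L) ⊓ unitaryGroupOfForm (conjMixed (↥(maximalRealSubfield L)) L (IsCMField.complexConj L)) 1)] [BorelSpace ↥(UnitaryGroup.arch (↥(maximalRealSubfield L)) L (IsCMField.complexConj L) 2 ((StdForm.antidiagonal 2).over L) ⊓ unitaryGroupOfForm (conjMixed (↥(maximalRealSubfield L)) L (IsCMField.complexConj L)) 1)]
    (μK : Measure ↥(UnitaryGroup.arch (↥(maximalRealSubfield L)) L (IsCMField.complexConj L) 2 ((StdForm.antidiagonal 2).over L) ⊓ unitaryGroupOfForm (conjMixed (↥(maximalRealSubfield L)) L (IsCMField.complexConj L)) 1)) [IsProbabilityMeasure μK] [μK.IsMulLeftInvariant] [μK.IsMulRightInvariant] [μK.IsInvInvariant]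
    (χ : C_c(↥(UnitaryGroup.arch (↥(maximalRealSubfield L)) L (IsCMField.complexConj L) 2 ((StdForm.antidiagonal 2).over L) ⊓ unitaryGroupOfForm (conjMixed (↥(maximalRealSubfield L)) L (IsCMField.complexConj L)) 1), ℂ)) (e : C_c(finAdelic (↥(maximalRealSubfield L)) L (IsCMField.complexConj L) 2 ((StdForm.antidiagonal 2).over L), ℂ))
    [MeasurableMul (finAdelic (↥(maximalRealSubfield L)) L (IsCMField.complexConj L) 2 ((StdForm.antidiagonal 2).over L))] [ENNReal.HolderTriple ∞ 2 2]
    [MeasurableSpace (quasiSplit (↥(maximalRealSubfield L)) L (IsCMField.complexConj L) 2).Adelic] [BorelSpace (quasiSplit (↥(maximalRealSubfield L)) L (IsCMField.complexConj L) 2).Adelic]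
    (hχ1 : ∀ k, χ k = 1)
    (he0 : ∀ x, x ∉ ((glFiniteIntegralLevel 2 L).comap (finAdelic (↥(maximalRealSubfield L)) L (IsCMField.complexConj L) 2 ((StdForm.antidiagonal 2).over L)).subtype : Subgroup (finAdelic (↥(maximalRealSubfield L)) L (IsCMField.complexConj L) 2 ((StdForm.antidiagonal 2).over L))) → e x = 0) (he1 : ∫ x, e x ∂νf = 1) (heK : ∀ k ∈ ((glFiniteIntegralLevel 2 L).comap (finAdelic (↥(maximalRealSubfield L)) L (IsCMField.complexConj L) 2 ((StdForm.antidiagonal 2).over L)).subtype : Subgroup (finAdelic (↥(maximalRealSubfield L)) L (IsCMField.complexConj L) 2 ((StdForm.antidiagonal 2).over L))), ∀ x, e (k * x) = e x) (hestar : ∀ x, mulStar (⇑e) x = e x)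
    (P : (quasiSplit (↥(maximalRealSubfield L)) L (IsCMField.complexConj L) 2).L2 μ →L[ℂ] (quasiSplit (↥(maximalRealSubfield L)) L (IsCMField.complexConj L) 2).L2 μ) (hPdef : P = (((quasiSplit (↥(maximalRealSubfield L)) L (IsCMField.complexConj L) 2).rightRegular μ).restrict ((archToAdelic (↥(maximalRealSubfield L)) L (IsCMField.complexConj L) 2 ((StdForm.antidiagonal 2).over L)).comp (Subgroup.inclusion (inf_le_left : UnitaryGroup.arch (↥(maximalRealSubfield L)) L (IsCMField.complexConj L) 2 ((StdForm.antidiagonal 2).over L) ⊓ unitaryGroupOfForm (conjMixed (↥(maximalRealSubfield L)) L (IsCMField.complexConj L)) 1 ≤ UnitaryGroup.arch (↥(maximalRealSubfield L)) L (IsCMField.complexConj L) 2 ((StdForm.antidiagonal 2).over L))))).integratedOperator (((quasiSplit (↥(maximalRealSubfield L)) L (IsCMField.complexConj L) 2).isUnitary_rightRegular μ).restrict _) (((quasiSplit (↥(maximalRealSubfield L)) L (IsCMField.complexConj L) 2).isStronglyContinuous_rightRegular_holds μ).restrict _ ((continuous_archToAdelic (↥(maximalRealSubfield L)) L (IsCMField.complexConj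 L) 2 ((StdForm.antidiagonal 2).over L)).comp (continuous_induced_rng.2 continuous_subtype_val))) μK χ ∘L (((quasiSplit (↥(maximalRealSubfield L)) L (IsCMField.complexConj L) 2).rightRegular μ).restrict (finAdelicToAdelic (↥(maximalRealSubfield L)) L (IsCMField.complexConj L) 2 ((StdForm.antidiagonal 2).over L))).integratedOperator (((quasiSplit (↥(maximalRealSubfield L)) L (IsCMField.complexConj L) 2).isUnitary_rightRegular μ).restrict _) (((quasiSplit (↥(maximalRealSubfield L)) L (IsCMField.complexConj L) 2).isStronglyContinuous_rightRegular_holds μ).restrict _ (continuous_finAdelicToAdelic (↥(maximalRealSubfield L)) L (IsCMField.complexConj L) 2 ((StdForm.antidiagonal 2).over L))) νf e)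
    (𝔓 : (quasiSplit (↥(maximalRealSubfield L)) L (IsCMField.complexConj L) 2).ParabolicUnipotentData) (hne : Nonempty 𝔓.ι) (h𝔓 : ∀ i : 𝔓.ι, 𝔓.radical i = adelicUnipotent (↥(maximalRealSubfield L)) L (IsCMField.complexConj L) 2) :
    FiniteDimensional ℂ ↥((residualSubspace (quasiSplit (↥(maximalRealSubfield L)) L (IsCMField.complexConj L) 2) μ 𝔓).toSubmodule ⊓
      ((((quasiSplit (↥(maximalRealSubfield L)) L (IsCMField.complexConj L) 2).rightRegular μ)).restrict ((finAdelicToAdelic (↥(maximalRealSubfield L)) L (IsCMField.complexConj L) 2 ((StdForm.antidiagonal 2).over L)).comp ((glFiniteIntegralLevel 2 L).comap (finAdelic (↥(maximalRealSubfield L)) L (IsCMField.complexConj L) 2 ((StdForm.antidiagonal 2).over L)).subtype : Subgroup (finAdelic (↥(maximalRealSubfield L)) L (IsCMField.complexConj L) 2 ((StdForm.antidiagonal 2).over L))).subtype)).invariants ⊓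
      ((((quasiSplit (↥(maximalRealSubfield L)) L (IsCMField.complexConj L) 2).rightRegular μ)).restrict ((archToAdelic (↥(maximalRealSubfield L)) L (IsCMField.complexConj L) 2 ((StdForm.antidiagonal 2).over L)).comp (Subgroup.inclusion (inf_le_left : UnitaryGroup.arch (↥(maximalRealSubfield L)) L (IsCMField.complexConj L) 2 ((StdForm.antidiagonal 2).over L) ⊓ unitaryGroupOfForm (conjMixed (↥(maximalRealSubfield L)) L (IsCMField.complexConj L)) 1 ≤ UnitaryGroup.arch (↥(maximalRealSubfield L)) L (IsCMField.complexConj L) 2 ((StdForm.antidiagonal 2).over L))))).invariants) := by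
  -- the M1 level data (★ `m1_level_witness`), the compact `K` and its Haar model measure
  obtain ⟨-, -, hU₀Kc, hK'U₀, hK'o, hU₀o, hU₀c⟩ := m1_level_witness L
  haveI : CompactSpace ↥((standardMaximalCompactGL 2 L).comap (adelicVal (↥(maximalRealSubfield L)) L (IsCMField.complexConj L) 2 ((StdForm.antidiagonal 2).over L)) : Subgroup (quasiSplit (↥(maximalRealSubfield L)) L (IsCMField.complexConj L) 2).Adelic) :=
    isCompact_iff_compactSpace.1 isCompact_comap_adelicVal_standardMaximalCompactGL
  -- ED. 1 with (C) ★ `hVc_maximalLevel` and `hSD` ★ `selfDual_block_package` per self-dual block `b`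
  refine residual_invariants_finiteDimensional_maximalLevel_cm_final μ νinf νf μK χ e hχ1 he0 he1 heK hestar P hPdef 𝔓 hne h𝔓 (hVc_maximalLevel L) fun b => ?_
  obtain ⟨⟨hray, hV⟩, hsd⟩ := b.2
  exact selfDual_block_package L μ νinf νf μK χ e hχ1 ((glFiniteIntegralLevel 2 L).comap (finAdelic (↥(maximalRealSubfield L)) L (IsCMField.complexConj L) 2 ((StdForm.antidiagonal 2).over L)).subtype : Subgroup (finAdelic (↥(maximalRealSubfield L)) L (IsCMField.complexConj L) 2 ((StdForm.antidiagonal 2).over L))) hK'o he0 he1 heK P hPdef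
    (glFiniteIntegralLevel 2 L) hU₀o hU₀c hK'U₀ hU₀Kc (haar : Measure ↥((standardMaximalCompactGL 2 L).comap (adelicVal (↥(maximalRealSubfield L)) L (IsCMField.complexConj L) 2 ((StdForm.antidiagonal 2).over L)) : Subgroup (quasiSplit (↥(maximalRealSubfield L)) L (IsCMField.complexConj L) 2).Adelic))
    (HeckeCharacter.isUnitary_of_map_posRealIdele hray) hray hsd hV (hVc_maximalLevel_one L _)
    {v : (quasiSplit (↥(maximalRealSubfield L)) L (IsCMField.complexConj L) 2).L2 μ |
            ∃ (f : ℝ → ℂ) (_ : Continuous f) (_ : HasCompactSupport f) (_ : tsupport f ⊆ Ioi 0)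
              (φ : (quasiSplit (↥(maximalRealSubfield L)) L (IsCMField.complexConj L) 2).Adelic → ℂ) (_ : φ ∈ chiSectionSpace (b : HeckeCharacter L) ((standardMaximalCompactGL 2 L).comap (adelicVal (↥(maximalRealSubfield L)) L (IsCMField.complexConj L) 2 ((StdForm.antidiagonal 2).over L)) : Subgroup (quasiSplit (↥(maximalRealSubfield L)) L (IsCMField.complexConj L) 2).Adelic) ((1 : ↥((standardMaximalCompactGL 2 L).comap (adelicVal (↥(maximalRealSubfield L)) L (IsCMField.complexConj L) 2 ((StdForm.antidiagonal 2).over L)) : Subgroup (quasiSplit (↥(maximalRealSubfield L)) L (IsCMField.complexConj L) 2).Adelic) →* ℂ) : ↥((standardMaximalCompactGL 2 L).comap (adelicVal (↥(maximalRealSubfield L)) L (IsCMField.complexConj L) 2 ((StdForm.antidiagonal 2).over L)) : Subgroup (quasiSplit (↥(maximalRealSubfield L)) L (IsCMField.complexConj L) 2).Adelic) → ℂ)) (_ : Continuous φ)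
              (hv : MemLp ((quasiSplit (↥(maximalRealSubfield L)) L (IsCMField.complexConj L) 2).quotFun (eisensteinSeriesU (fun g => f (borelHeight g) * φ g))) 2 μ), v = hv.toLp _} rfl

end Summit.HodgeConjecture.HodgeConjecture.Cruxes.H413.K2E1ResidualSphericalFiniteMaximalLevelCMTwoClosed

end
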